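import Mathlib
import HarnessLib
import Summits.BirchSwinnertonDyer.BirchSwinnertonDyer.Theses.ManinLocalTwoThree
import Summits.BirchSwinnertonDyer.BirchSwinnertonDyer.Theorems.ManinLocalTwoThreeCDivisionAssembly
import Literature.NumberTheory.Automorphic.UnboundedDenominators

/-!
# Lines/cdivision_udc.lean (C2, CANDIDATE for the LEAD) — v1 (p3 gen 18, 2026-08-30T01:xxZ; design -an g44 MEMO-an §89 «THE c-DIVISION WITNESS»):
# C2 `ManinOddAtFour` ⟸ CDT ∧ E-an-152b `ShimuraIndexNeFourAtFour`.
# The analytic witness is a kernel theorem (`CDivAssembly.exists_cDivisionWitness`; nodes N1–N5 p2 g20, N6–N7 p3 g18): for EVERY X₀(N)-datum a holomorphic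
# `F = 12·℘_{Λ_W}(ℰ_f)·G·Δ^a` with Γ₀(N)-stabiliser EXACTLY `Γ^{(c)}`, bounded at the cusps, integer q-expansion.  CDT ⟹ congruence ⟹ `Γ(MN) ≤ Γ^{(c)} ≤ Γ^{(2)}`
# (2 ∣ c) ⟹ the index-4 configuration `Λ₁ = 2Λ₀` ⟹ excluded by E-an-152b.  COMPOSITION `CDivAssembly.maninOddAtFour_of_CDT_indexNeFour`.
# STUBS (2): `stub_CDT_algInt` (PRINTED, cite-only) · `stub_shimuraIndexNeFourAtFour` (E-an-152b, OPEN: no index-4 world at 4 ∣ N; a THEOREM at 2-power and 16p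
# levels in the tree).  Versus halving_udc v1: the OPEN analytic stub `stub_halvingWitnessLaw` is GONE.
# HONEST FRAMING: CONDITIONAL reduction — C2 holds modulo CDT (printed, not proved in the tree) and E-an-152b (open); BSD is not proved; Manin's conjecture at 2
# is not proved.
-/

set_option autoImplicit false
set_option linter.dupNamespace false

noncomputable section

open Summit.BirchSwinnertonDyer.Rank1Residual.ManinAdditive.ShimuraKernel

namespace Summit.BirchSwinnertonDyer.BirchSwinnertonDyer.Cruxes.ManinOddAtFour.CDivisionUDC

/-- STUB (PRINTED) CDT-algInt — Calegari–Dimitrov–Tang 2025 Thm. 1.0.1 with Remarks 58–59; CITE-ONLY. [cite: CalegariDimitrovTang2025, Thm. 1.0.1 and Remarks 58–59] -/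
theorem stub_CDT_algInt : Literature.NumberTheory.Automorphic.CalegariDimitrovTang2025_unboundedDenominators_algInt := by
  sorry

/-- STUB (OPEN) E-an-152b — at `4 ∣ N` no lattice-optimal datum has `Λ₁(f) = 2Λ₀(f)` (the index-`4` Shimura configuration). -/
theorem stub_shimuraIndexNeFourAtFour : ShimuraIndexNeFourAtFour := by
  sorry

/-- COMPOSITION (no sorry): `CDivAssembly.maninOddAtFour_of_CDT_indexNeFour` (p3 g18; c-division witness of -an g44, nodes p2 g20 / p3 g18). -/
theorem ManinOddAtFour_of :
    Summit.BirchSwinnertonDyer.BirchSwinnertonDyer.Theses.ManinLocalTwoThree.ManinOddAtFour :=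
  Summit.BirchSwinnertonDyer.BirchSwinnertonDyer.Theorems.ManinLocalTwoThree.CDivAssembly.maninOddAtFour_of_CDT_indexNeFour
    stub_CDT_algInt stub_shimuraIndexNeFourAtFour

end Summit.BirchSwinnertonDyer.BirchSwinnertonDyer.Cruxes.ManinOddAtFour.CDivisionUDC

end
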